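import Mathlib

/-!
# BirchSwinnertonDyer — rank ≥ 2 observatory, KERNEL-3ISO (B3b core): cubes up to units and bad primes in a PID

HONEST FRAMING: per-curve certified theorems and census instruments; no claim on BSD in rank ≥ 2.

The Ê-side support law of the `3`-isogeny descent (Cohen, *Number Theory I*, Prop. 8.4.8 (3); Cohen–Pazuki
§2) rests on one piece of pure algebra in the ring of integers `ℤ[ζ₃]` (a PID): if `δ δ̄ = A³` and every
prime dividing both `δ` and `δ̄` is (associated to) one of finitely many BAD primes `q ∈ P`, then
`δ = unit · ∏_{q ∈ P} q^{k_q} · w³`. This file proves it for any principal ideal domain `R`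
(no number-field input; the instantiation `R = 𝓞 ℚ(ζ₃)` with Mathlib's
`IsCyclotomicExtension.Rat.three_pid` is B3b):

* `exists_prod_pow_mul_not_dvd` — STRIP: `x ≠ 0` is `(∏_{q ∈ P} q^{k_q}) · x'` with no `q ∈ P` dividing `x'`;
* `isRelPrime_prod_pow_of_not_dvd` — such an `x'` is coprime to every product of powers of the `q ∈ P`;
* `exists_eq_unit_mul_prod_pow_mul_cube` — **the lemma**: `δ ε = A³`, common primes of `δ, ε` bad
  `⇒ ∃ u k w, δ = u · (∏_{q ∈ P} q^{k_q}) · w³` (`u` a unit); `exists_eq_unit_mul_prod_pow_lt_mul_cube` —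
  the same with all `k_q < 3` (so the descent class of `δ` is one of `#(units/cubes) · 3^{#P}` classes).

No definitions. References: H. Cohen, *Number Theory I* (GTM 239, 2007), Prop. 8.4.8 (3);
H. Cohen, F. Pazuki, arXiv:0903.4963, Prop. 2.2.
-/

set_option linter.dupNamespace false

namespace Summit.BirchSwinnertonDyer.BirchSwinnertonDyer.Rank2Observatory.ThreeIso

section Strip

variable {R : Type*} [CommRing R]

/-- **Strip the bad primes**: for a finite set `P` of non-units and `x ≠ 0`,
`x = (∏_{q ∈ P} q^{k q}) · x'` with `x' ≠ 0` and `q ∤ x'` for every `q ∈ P`. [folklore] -/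
theorem exists_prod_pow_mul_not_dvd [UniqueFactorizationMonoid R] (P : Finset R) (hP : ∀ q ∈ P, ¬IsUnit q) {x : R} (hx : x ≠ 0) :
    ∃ (k : R → ℕ) (x' : R), x = (∏ q ∈ P, q ^ k q) * x' ∧ x' ≠ 0 ∧ ∀ q ∈ P, ¬q ∣ x' := by
  classical
  induction P using Finset.induction_on with
  | empty => exact ⟨fun _ => 0, x, by simp, hx, by simp⟩
  | @insert a s ha ih =>
    obtain ⟨k, x', hxeq, hx', hnd⟩ := ih (fun q hq => hP q (Finset.mem_insert_of_mem hq))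
    obtain ⟨n, x'', hndvd, hx'eq⟩ :=
      WfDvdMonoid.max_power_factor' hx' (hP a (Finset.mem_insert_self a s))
    refine ⟨Function.update k a n, x'', ?_, ?_, ?_⟩
    · rw [Finset.prod_insert ha, Function.update_self,
        Finset.prod_congr rfl fun q hq => by rw [Function.update_of_ne (ne_of_mem_of_not_mem hq ha)],
        hxeq, hx'eq]
      ring
    · rintro rfl; exact hx' (by rw [hx'eq, mul_zero])
    · intro q hq
      rcases Finset.mem_insert.mp hq with rfl | hq
      · exact hndvd
      · intro hdvd
        exact hnd q hq (by rw [hx'eq]; exact dvd_mul_of_dvd_right hdvd _)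

/-- An element with no divisor among the primes `q ∈ P` is relatively prime to any `∏_{q ∈ P} q^{k q}`.
[folklore] -/
theorem isRelPrime_prod_pow_of_not_dvd [IsDomain R] [UniqueFactorizationMonoid R] (P : Finset R) (hP : ∀ q ∈ P, Prime q) {x : R} (hx : x ≠ 0)
    (h : ∀ q ∈ P, ¬q ∣ x) (k : R → ℕ) : IsRelPrime x (∏ q ∈ P, q ^ k q) := by
  rw [UniqueFactorizationMonoid.isRelPrime_iff_no_prime_factors hx]
  intro d hdx hdprod hd
  obtain ⟨q, hq, hdq⟩ := hd.exists_mem_finset_dvd hdprod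
  have hdq' : d ∣ q := hd.dvd_of_dvd_pow hdq
  have hassoc : Associated d q := hd.irreducible.associated_of_dvd (hP q hq).irreducible hdq'
  exact h q hq (hassoc.symm.dvd.trans hdx)

/-- A product of two elements with no divisor among the primes `q ∈ P` has none either. [folklore] -/
theorem not_dvd_mul_of_not_dvd (P : Finset R) (hP : ∀ q ∈ P, Prime q) {x y : R}
    (hx : ∀ q ∈ P, ¬q ∣ x) (hy : ∀ q ∈ P, ¬q ∣ y) : ∀ q ∈ P, ¬q ∣ x * y := fun q hq hq' =>
  ((hP q hq).dvd_or_dvd hq').elim (hx q hq) (hy q hq)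

end Strip

section Cube

variable {R : Type*} [CommRing R] [IsDomain R] [IsPrincipalIdealRing R]

/-- **Cubes up to units and bad primes.** In a PID: if `δ ε = A³` with `δ, ε ≠ 0` and every prime dividing
both `δ` and `ε` is associated to some `q ∈ P` (a finite set of primes), then
`δ = u · (∏_{q ∈ P} q^{k q}) · w³` for a unit `u`. [cite: Cohen2007NumberTheoryI, Prop. 8.4.8 (3)] -/
theorem exists_eq_unit_mul_prod_pow_mul_cube (P : Finset R) (hP : ∀ q ∈ P, Prime q) {δ ε A : R}
    (hδ : δ ≠ 0) (hε : ε ≠ 0) (hprod : δ * ε = A ^ 3)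
    (hcommon : ∀ π : R, Prime π → π ∣ δ → π ∣ ε → ∃ q ∈ P, Associated π q) :
    ∃ (u : Rˣ) (k : R → ℕ) (w : R), δ = u * (∏ q ∈ P, q ^ k q) * w ^ 3 := by
  classical
  have hPu : ∀ q ∈ P, ¬IsUnit q := fun q hq => (hP q hq).not_unit
  have hA : A ≠ 0 := by
    rintro rfl; exact mul_ne_zero hδ hε (by rw [hprod]; ring)
  -- strip the bad primes from δ, ε, A
  obtain ⟨kδ, δ', hδeq, hδ', hδnd⟩ := exists_prod_pow_mul_not_dvd P hPu hδ
  obtain ⟨kε, ε', hεeq, hε', hεnd⟩ := exists_prod_pow_mul_not_dvd P hPu hε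
  obtain ⟨kA, A', hAeq, hA', hAnd⟩ := exists_prod_pow_mul_not_dvd P hPu hA
  -- the stripped identity: (δ'ε') · bδ bε = A'³ · bA³
  have hid : δ' * ε' * ((∏ q ∈ P, q ^ kδ q) * ∏ q ∈ P, q ^ kε q) =
      A' ^ 3 * ∏ q ∈ P, q ^ (3 * kA q) := by
    have : (∏ q ∈ P, q ^ (3 * kA q)) = (∏ q ∈ P, q ^ kA q) ^ 3 := by
      rw [← Finset.prod_pow]; exact Finset.prod_congr rfl fun q _ => by ring
    rw [this]
    calc δ' * ε' * ((∏ q ∈ P, q ^ kδ q) * ∏ q ∈ P, q ^ kε q)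
        = ((∏ q ∈ P, q ^ kδ q) * δ') * ((∏ q ∈ P, q ^ kε q) * ε') := by ring
      _ = A ^ 3 := by rw [← hδeq, ← hεeq, hprod]
      _ = ((∏ q ∈ P, q ^ kA q) * A') ^ 3 := by rw [← hAeq]
      _ = A' ^ 3 * (∏ q ∈ P, q ^ kA q) ^ 3 := by ring
  have hbb : (∏ q ∈ P, q ^ kδ q) * ∏ q ∈ P, q ^ kε q = ∏ q ∈ P, q ^ (kδ q + kε q) := by
    rw [← Finset.prod_mul_distrib]; exact Finset.prod_congr rfl fun q _ => by ring
  rw [hbb] at hid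
  -- δ'ε' and A'³ are associated
  have hδε'nd := not_dvd_mul_of_not_dvd P hP hδnd hεnd
  have hA3nd : ∀ q ∈ P, ¬q ∣ A' ^ 3 := fun q hq h3 => hAnd q hq ((hP q hq).dvd_of_dvd_pow h3)
  have h1 : δ' * ε' ∣ A' ^ 3 :=
    (isRelPrime_prod_pow_of_not_dvd P hP (mul_ne_zero hδ' hε') hδε'nd _).dvd_of_dvd_mul_left
      (y := ∏ q ∈ P, q ^ (3 * kA q)) ⟨∏ q ∈ P, q ^ (kδ q + kε q), by rw [mul_comm, ← hid]⟩
  have h2 : A' ^ 3 ∣ δ' * ε' :=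
    (isRelPrime_prod_pow_of_not_dvd P hP (pow_ne_zero 3 hA') hA3nd _).dvd_of_dvd_mul_left
      (y := ∏ q ∈ P, q ^ (kδ q + kε q)) ⟨∏ q ∈ P, q ^ (3 * kA q), by rw [mul_comm, hid]⟩
  have hassoc : Associated (A' ^ 3) (δ' * ε') := associated_of_dvd_dvd h2 h1
  -- δ' and ε' are coprime: a common prime divides δ and ε, so is bad, so divides δ' — excluded
  have hcop : IsCoprime δ' ε' := by
    refine IsRelPrime.isCoprime ((UniqueFactorizationMonoid.isRelPrime_iff_no_prime_factors hδ').mpr ?_)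
    intro d hdδ hdε hd
    obtain ⟨q, hq, hdq⟩ := hcommon d hd (hdδ.trans ⟨_, by rw [hδeq, mul_comm]⟩)
      (hdε.trans ⟨_, by rw [hεeq, mul_comm]⟩)
    exact hδnd q hq (hdq.symm.dvd.trans hdδ)
  obtain ⟨w, hw⟩ := exists_associated_pow_of_associated_pow_mul hcop hassoc
  obtain ⟨u, hu⟩ := hw
  exact ⟨u, kδ, w, by rw [hδeq, ← hu]; ring⟩

/-- **Cubes up to units and bad primes, reduced exponents**: as `exists_eq_unit_mul_prod_pow_mul_cube`
with all exponents `< 3`. [cite: Cohen2007NumberTheoryI, Prop. 8.4.8 (3)] -/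
theorem exists_eq_unit_mul_prod_pow_lt_mul_cube (P : Finset R) (hP : ∀ q ∈ P, Prime q) {δ ε A : R}
    (hδ : δ ≠ 0) (hε : ε ≠ 0) (hprod : δ * ε = A ^ 3)
    (hcommon : ∀ π : R, Prime π → π ∣ δ → π ∣ ε → ∃ q ∈ P, Associated π q) :
    ∃ (u : Rˣ) (k : R → ℕ) (w : R), (∀ q, k q < 3) ∧ δ = u * (∏ q ∈ P, q ^ k q) * w ^ 3 := by
  obtain ⟨u, k, w, h⟩ := exists_eq_unit_mul_prod_pow_mul_cube P hP hδ hε hprod hcommon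
  refine ⟨u, fun q => k q % 3, (∏ q ∈ P, q ^ (k q / 3)) * w, fun q => Nat.mod_lt _ (by norm_num), ?_⟩
  have hsplit : (∏ q ∈ P, q ^ k q) = (∏ q ∈ P, q ^ (k q % 3)) * (∏ q ∈ P, q ^ (k q / 3)) ^ 3 := by
    rw [← Finset.prod_pow, ← Finset.prod_mul_distrib]
    refine Finset.prod_congr rfl fun q _ => ?_
    rw [← pow_mul, ← pow_add]
    congr 1; omega
  rw [h, hsplit]; ring

end Cube

end Summit.BirchSwinnertonDyer.BirchSwinnertonDyer.Rank2Observatory.ThreeIso
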